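import Literature.AlgebraicGeometry.Resolution.RegularLocalOrderValuation
import Literature.AlgebraicGeometry.Resolution.RegularLocalRingsJacobian
import Mathlib.RingTheory.RegularLocalRing.Polynomial
import Mathlib.RingTheory.Localization.AtPrime.Basic
import Mathlib.RingTheory.Polynomial.Quotient
import Mathlib.Algebra.MvPolynomial.Equiv
import HarnessLib

/-!
# The e.f.t. local weighted game (H2a′), dim 2: the order of the exceptional axis `X₁` is one (K3b-ii)

Topic: `Summits/ResolutionOfSingularities/ResolutionOfSingularities/Theorems`. Helper for the door item
`HypersurfaceCentreConstruction` (statement `stmt-ResolutionOfSingularities-19897`, route `WeightedInvariant`);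
kernel **K3b-ii** of the dim-2 design memo `L/res-type-098-w43/EFT-DIM2-DESIGN.md` v2 §B (ORDER (o13) of
`res-L1-w43-plan-1`, dealt to res-D-pv-036 by RULINGS gen 8 #2), consumed by K3b-iii (case C drop) through K3b-i's
exceptional-chart isomorphism `B_𝔫/(t⁻¹) ≅ κ[X₀,X₁]_{𝔫̄}`.

[OURS · L1 W4.3] Pure commutative algebra over a field; replaces the role of NO printed item; NOT a statement of
the manuscript [claim: Hironaka2017, status: under-review]. AI work, weaker than expert review.

## Content

`κ` a field, `𝔫̄` a prime of `κ[X₀,X₁] = MvPolynomial (Fin 2) κ` containing `X₁`, `R = κ[X₀,X₁]_{𝔫̄}`: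

* `nonempty_ringEquiv_quotient_span_X_one` / `isRegularRing_quotient_span_X_one` — `κ[X₀,X₁]/(X₁) ≅ κ[X₀]` is regular;
* `isRegularLocalRing_localization_quotient_span_X_one` — `R/(X₁) ≅ (κ[X₀,X₁]/(X₁))_{𝔫̄/(X₁)}` is regular;
* `adicOrder_X_one` — **`ord_R(X₁) = 1`** (`≥ 1` as `X₁ ∈ 𝔫̄`; `≤ 1` since `R/(X₁)` regular forces `X₁ ∉ 𝔪_R²`,
  tree `not_isRegularLocalRing_quotient_span_singleton_of_mem_sq`);
* `adicOrder_mul_X_one_pow` — `ord_R(v·X₁ʲ) = j` for a unit `v` (the order of a regular local ring is a valuation,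
  tree `adicOrder_mul` / `adicOrder_pow`);
* `algebraMap_C_mul_X_pow_mul_X_pow_not_mem_pow` — the SIGNATURE OF THE MEMO: for `X₀ ∉ 𝔫̄`, `c ≠ 0` and all `i j`,
  `c·X₀ⁱ·X₁ʲ ∉ 𝔪_R^{j+1}` in `R`.
-/

noncomputable section

open IsLocalRing Literature.AlgebraicGeometry.Resolution MvPolynomial

set_option linter.dupNamespace false -- mandated namespace of this single-conjunct summit

namespace Summit.ResolutionOfSingularities.ResolutionOfSingularities.Theorems

namespace LocalGameEFTPointMove

universe u

variable {κ : Type u} [Field κ]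

/-! ## `κ[X₀,X₁]/(X₁) ≅ κ[X₀]` -/

/-- **`κ[X₀,X₁]/(X₁) ≅ κ[X₀]`** (as `MvPolynomial (Fin 1) κ`): swap the variables, single out the first one
(`κ[X₀,X₁] ≃ κ[X₀][T]`, `X₁ ↦ T`) and evaluate `T ↦ 0`. Stated as `Nonempty` (no definition). [folklore] -/
theorem nonempty_ringEquiv_quotient_span_X_one :
    Nonempty ((MvPolynomial (Fin 2) κ ⧸ Ideal.span {(X 1 : MvPolynomial (Fin 2) κ)}) ≃+*
      MvPolynomial (Fin 1) κ) := by
  let e : MvPolynomial (Fin 2) κ ≃ₐ[κ] Polynomial (MvPolynomial (Fin 1) κ) :=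
    (renameEquiv κ (Equiv.swap (0 : Fin 2) 1)).trans (finSuccEquiv κ 1)
  have he : e (X 1) = Polynomial.X := by
    simp [e, finSuccEquiv_X_zero]
  exact ⟨(Ideal.quotientEquiv (Ideal.span {(X 1 : MvPolynomial (Fin 2) κ)})
      (Ideal.span {Polynomial.X - Polynomial.C (0 : MvPolynomial (Fin 1) κ)}) e.toRingEquiv (by
        rw [Ideal.map_span, Set.image_singleton, map_zero, sub_zero]
        congr 2
        exact he.symm)).trans
    (Polynomial.quotientSpanXSubCAlgEquiv (0 : MvPolynomial (Fin 1) κ)).toRingEquiv⟩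

/-- `κ[X₀,X₁]/(X₁)` is a regular ring (it is `κ[X₀]`). [folklore] -/
theorem isRegularRing_quotient_span_X_one :
    IsRegularRing (MvPolynomial (Fin 2) κ ⧸ Ideal.span {(X 1 : MvPolynomial (Fin 2) κ)}) := by
  obtain ⟨e⟩ := nonempty_ringEquiv_quotient_span_X_one (κ := κ)
  exact IsRegularRing.of_ringEquiv e.symm

/-! ## Localising at a prime `𝔫̄ ∋ X₁` -/

variable (𝔫 : Ideal (MvPolynomial (Fin 2) κ)) [𝔫.IsPrime]

/-- **`κ[X₀,X₁]_{𝔫̄}/(X₁)` is a regular local ring** for a prime `𝔫̄ ∋ X₁`: it is the localisation of the regular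
ring `κ[X₀,X₁]/(X₁) ≅ κ[X₀]` at the prime `𝔫̄/(X₁)` (same transport as the tree's
`isRegularLocalRing_localization_of_mem_of_quotient`). [folklore] -/
theorem isRegularLocalRing_localization_quotient_span_X_one (h1 : (X 1 : MvPolynomial (Fin 2) κ) ∈ 𝔫) :
    IsRegularLocalRing (Localization.AtPrime 𝔫 ⧸
      Ideal.span {algebraMap (MvPolynomial (Fin 2) κ) (Localization.AtPrime 𝔫) (X 1)}) := by
  set S := MvPolynomial (Fin 2) κ
  set J : Ideal S := Ideal.span {(X 1 : S)} with hJ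
  haveI : IsRegularRing (S ⧸ J) := isRegularRing_quotient_span_X_one
  have hJQ : J ≤ 𝔫 := (Ideal.span_singleton_le_iff_mem _).mpr h1
  set Qbar : Ideal (S ⧸ J) := 𝔫.map (Ideal.Quotient.mk J) with hQbar
  have hcomap : Qbar.comap (Ideal.Quotient.mk J) = 𝔫 := by
    rw [hQbar, Ideal.comap_map_of_surjective _ Ideal.Quotient.mk_surjective,
      ← RingHom.ker_eq_comap_bot, Ideal.mk_ker, sup_eq_left]
    exact hJQ
  haveI hQbarp : Qbar.IsPrime :=
    Ideal.map_isPrime_of_surjective Ideal.Quotient.mk_surjective (by rwa [Ideal.mk_ker])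
  have hmemQ : ∀ c : S, Ideal.Quotient.mk J c ∈ Qbar ↔ c ∈ 𝔫 := fun c => by
    rw [← Ideal.mem_comap, hcomap]
  have hM : Algebra.algebraMapSubmonoid (S ⧸ J) 𝔫.primeCompl = Qbar.primeCompl := by
    ext b
    constructor
    · rintro ⟨c, hc, rfl⟩
      exact fun h => hc ((hmemQ c).mp h)
    · intro hb
      obtain ⟨c, rfl⟩ := Ideal.Quotient.mk_surjective b
      exact ⟨c, fun h => hb ((hmemQ c).mpr h), rfl⟩
  haveI : IsLocalization.AtPrime
      (Localization.AtPrime 𝔫 ⧸ J.map (algebraMap S (Localization.AtPrime 𝔫))) Qbar := by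
    have := (inferInstance : IsLocalization (Algebra.algebraMapSubmonoid (S ⧸ J) 𝔫.primeCompl)
      (Localization.AtPrime 𝔫 ⧸ J.map (algebraMap S (Localization.AtPrime 𝔫))))
    rwa [hM] at this
  have e := (IsLocalization.algEquiv Qbar.primeCompl
    (Localization.AtPrime 𝔫 ⧸ J.map (algebraMap S (Localization.AtPrime 𝔫)))
    (Localization.AtPrime Qbar)).toRingEquiv
  haveI hQreg : IsRegularLocalRing (Localization.AtPrime Qbar) :=
    IsRegularRing.isRegularLocalRing_localization Qbar
  haveI : IsRegularLocalRing
      (Localization.AtPrime 𝔫 ⧸ J.map (algebraMap S (Localization.AtPrime 𝔫))) :=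
    IsRegularLocalRing.of_ringEquiv (R := Localization.AtPrime Qbar) e.symm
  have hJt : J.map (algebraMap S (Localization.AtPrime 𝔫)) =
      Ideal.span {algebraMap S (Localization.AtPrime 𝔫) (X 1)} := by
    rw [hJ, Ideal.map_span, Set.image_singleton]
  exact IsRegularLocalRing.of_ringEquiv
    (R := Localization.AtPrime 𝔫 ⧸ J.map (algebraMap S (Localization.AtPrime 𝔫))) (Ideal.quotEquivOfEq hJt)

/-- **`ord(X₁) = 1` in `κ[X₀,X₁]_{𝔫̄}`** for a prime `𝔫̄ ∋ X₁`: `X₁ ∈ 𝔪`, and `X₁ ∉ 𝔪²` because the quotient by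
`X₁` is a regular local ring (Matsumura 14.2, tree `not_isRegularLocalRing_quotient_span_singleton_of_mem_sq`).
[folklore] -/
theorem adicOrder_X_one (h1 : (X 1 : MvPolynomial (Fin 2) κ) ∈ 𝔫) :
    adicOrder (algebraMap (MvPolynomial (Fin 2) κ) (Localization.AtPrime 𝔫) (X 1)) = 1 := by
  set S := MvPolynomial (Fin 2) κ
  set R := Localization.AtPrime 𝔫
  set x₁ : R := algebraMap S R (X 1) with hx₁
  have hinj : Function.Injective (algebraMap S R) :=
    IsLocalization.injective R 𝔫.primeCompl_le_nonZeroDivisors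
  have hx₁0 : x₁ ≠ 0 := fun h => X_ne_zero (R := κ) (1 : Fin 2) (hinj (by rw [map_zero]; exact h))
  have hx₁m : x₁ ∈ maximalIdeal R := by
    rw [← Localization.AtPrime.map_eq_maximalIdeal]
    exact Ideal.mem_map_of_mem _ h1
  have hreg := isRegularLocalRing_localization_quotient_span_X_one 𝔫 h1
  have hx₁2 : x₁ ∉ maximalIdeal R ^ 2 := fun h =>
    not_isRegularLocalRing_quotient_span_singleton_of_mem_sq hx₁0 h hreg
  refine le_antisymm ?_ ?_
  · have := (adicOrder_le_iff x₁ 1).mpr hx₁2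
    exact_mod_cast this
  · have := (le_adicOrder_iff x₁ 1).mpr (by rwa [pow_one])
    exact_mod_cast this

/-- **`ord(v · X₁ʲ) = j`** in `κ[X₀,X₁]_{𝔫̄}` (`𝔫̄ ∋ X₁` prime) for every unit `v`: the order of the regular local
ring `κ[X₀,X₁]_{𝔫̄}` is additive (`adicOrder_mul`, `adicOrder_pow`). [folklore] -/
theorem adicOrder_mul_X_one_pow (h1 : (X 1 : MvPolynomial (Fin 2) κ) ∈ 𝔫) {v : Localization.AtPrime 𝔫}
    (hv : IsUnit v) (j : ℕ) :
    adicOrder (v * algebraMap (MvPolynomial (Fin 2) κ) (Localization.AtPrime 𝔫) (X 1) ^ j) = j := by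
  rw [adicOrder_mul, adicOrder_pow, adicOrder_of_isUnit hv, adicOrder_X_one 𝔫 h1, zero_add, mul_one]

/-- **K3b-ii (signature of the memo): `c·X₀ⁱ·X₁ʲ ∉ 𝔪^{j+1}` in `κ[X₀,X₁]_{𝔫̄}`** for a prime `𝔫̄` with `X₁ ∈ 𝔫̄`,
`X₀ ∉ 𝔫̄`, a non-zero scalar `c` and all `i, j` — `c` and `X₀` are units of the local ring, so the order of the
element is `j · ord(X₁) = j < j + 1`. [folklore] -/
theorem algebraMap_C_mul_X_pow_mul_X_pow_not_mem_pow (h1 : (X 1 : MvPolynomial (Fin 2) κ) ∈ 𝔫)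
    (h0 : (X 0 : MvPolynomial (Fin 2) κ) ∉ 𝔫) {c : κ} (hc : c ≠ 0) (i j : ℕ) :
    algebraMap (MvPolynomial (Fin 2) κ) (Localization.AtPrime 𝔫) (C c * X 0 ^ i * X 1 ^ j) ∉
      maximalIdeal (Localization.AtPrime 𝔫) ^ (j + 1) := by
  set S := MvPolynomial (Fin 2) κ
  set R := Localization.AtPrime 𝔫
  have hu0 : IsUnit (algebraMap S R (X 0)) := IsLocalization.map_units R (⟨X 0, h0⟩ : 𝔫.primeCompl)
  have huc : IsUnit (algebraMap S R (C c)) := (hc.isUnit.map (C : κ →+* S)).map (algebraMap S R)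
  have hv : IsUnit (algebraMap S R (C c) * algebraMap S R (X 0) ^ i) := huc.mul (hu0.pow i)
  have hord : adicOrder (algebraMap S R (C c * X 0 ^ i * X 1 ^ j)) = j := by
    rw [map_mul, map_mul, map_pow, map_pow]
    exact adicOrder_mul_X_one_pow 𝔫 h1 hv j
  rw [← adicOrder_lt_iff, hord]
  exact_mod_cast Nat.lt_succ_self j

/-! ## v2 (append-only): the bridge inputs for K3b-iii, free of the `X₀ ∉ 𝔫̄` hypothesis -/

/-- **`X₁ ∉ 𝔪²` in `κ[X₀,X₁]_{𝔫̄}`** for every prime `𝔫̄ ∋ X₁` (no hypothesis on `X₀`): the bridge input of K3b-iii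
(«`mk ψ(u₁t^{w₁}) ∉ 𝔪²` in `B_𝔫/(t⁻¹)`», after K3b-i's `B_𝔫/(t⁻¹) ≅ κ[X₀,X₁]_{𝔫̄}`), read off `adicOrder_X_one`.
[folklore] -/
theorem algebraMap_X_one_not_mem_sq (h1 : (X 1 : MvPolynomial (Fin 2) κ) ∈ 𝔫) :
    algebraMap (MvPolynomial (Fin 2) κ) (Localization.AtPrime 𝔫) (X 1) ∉
      maximalIdeal (Localization.AtPrime 𝔫) ^ 2 := by
  rw [← adicOrder_lt_iff, adicOrder_X_one 𝔫 h1]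
  exact_mod_cast Nat.lt_succ_self 1

/-- **`X₁ʲ ∉ 𝔪^{j+1}` and `v·X₁ʲ ∉ 𝔪^{j+1}` for a unit `v`** in `κ[X₀,X₁]_{𝔫̄}`, `𝔫̄ ∋ X₁` prime (no hypothesis on
`X₀`; `v = ē(c̄·X₀ⁱ)` in K3b-iii). [folklore] -/
theorem mul_X_one_pow_not_mem_pow (h1 : (X 1 : MvPolynomial (Fin 2) κ) ∈ 𝔫) {v : Localization.AtPrime 𝔫}
    (hv : IsUnit v) (j : ℕ) :
    v * algebraMap (MvPolynomial (Fin 2) κ) (Localization.AtPrime 𝔫) (X 1) ^ j ∉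
      maximalIdeal (Localization.AtPrime 𝔫) ^ (j + 1) := by
  rw [← adicOrder_lt_iff, adicOrder_mul_X_one_pow 𝔫 h1 hv j]
  exact_mod_cast Nat.lt_succ_self j

/-- … while `v·X₁ʲ ∈ 𝔪ʲ` (the order is exactly `j`). [folklore] -/
theorem mul_X_one_pow_mem_pow (h1 : (X 1 : MvPolynomial (Fin 2) κ) ∈ 𝔫) (v : Localization.AtPrime 𝔫)
    (j : ℕ) :
    v * algebraMap (MvPolynomial (Fin 2) κ) (Localization.AtPrime 𝔫) (X 1) ^ j ∈
      maximalIdeal (Localization.AtPrime 𝔫) ^ j := by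
  refine Ideal.mul_mem_left _ v (Ideal.pow_mem_pow ?_ j)
  rw [← Localization.AtPrime.map_eq_maximalIdeal]
  exact Ideal.mem_map_of_mem _ h1

end LocalGameEFTPointMove

end Summit.ResolutionOfSingularities.ResolutionOfSingularities.Theorems

end
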